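import Summits.BirchSwinnertonDyer.BirchSwinnertonDyer.Theorems.ManinLocalTwoThreeBlindFamilyTwoDescentSelmer
import Literature.NumberTheory.EllipticCurves.BSDInvariants
import Literature.NumberTheory.EllipticCurves.RegulatorProofs
import Literature.NumberTheory.EllipticCurves.MordellWeilRankZeroProofs
import HarnessLib

/-!
# The blind families are `2`-Selmer-minimal, II: rank `0` and `Ш[2] = 0` for `E'_m` and `E_m`

Summit `BirchSwinnertonDyer`, route `ManinLocalTwoThree` (cell bsd-f2-manin), crux C2 `ManinOddAtFour` (stmt-BirchSwinnertonDyer-22967),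
the totally-blind residual.  PORT (lead p1 g5) of Part A §3–§6 of HOME/an/Sketch-an-g23.lean (an g23, MEMO-an §65; farm rc 0, axioms
standard), statements and proofs VERBATIM, namespace moved under `Theorems`:

* `mordellWeilRank_blindCurve_eq_zero`, `mordellWeilRank_sourceCurve_eq_zero` — `rank E'_m(ℚ) = rank E_m(ℚ) = 0`
  (`rank + 2 ≤ dim S + dim S'`, the tree's `twoIsogeny_mordellWeilRank_add_two_le_holds`);
* `sha_blindCurve_two_torsion_eq_zero`, `sha_sourceCurve_two_torsion_eq_zero` — `Ш(E'_m)[2] = 0`, `Ш(E_m)[2] = 0` (both Selmer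
  groups are exhausted by the images of the `2`-torsion);
* `finite_point_blindCurve`, `regulator_blindCurve`, `not_two_dvd_shaOrder_blindCurve` — `E'_m(ℚ)` finite (tree Mordell–Weil),
  `Reg = 1`, `#Ш` odd once finite (MEMO-an §65 (B));
* `blindFamily_twoSelmerMinimal` — **THEOREM (E-an-104)**: for every odd `m` with `p = m² + 4` prime the class `{E_m, E'_m}` is
  `2`-Selmer-minimal (both the tame `N = 4p` and the wild `N = 16p` family; `c`-free, `L`-free).

Nothing about BSD or Manin's conjecture is proved; nothing is asserted about `c`.
[cite: SilvermanTate2015, §3.6] [cite: SilvermanAEC2009, X.4.9, X.4.2(a)]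
-/

set_option autoImplicit false
set_option linter.dupNamespace false

noncomputable section

open scoped Classical

namespace Summit.BirchSwinnertonDyer.BirchSwinnertonDyer.Theorems.ManinLocalTwoThree.BlindFamilyDescent

open _root_.WeierstrassCurve _root_.WeierstrassCurve.Affine
open Literature.NumberTheory.EllipticCurves Literature.NumberTheory.DiophantineGeometry
open Summit.BirchSwinnertonDyer.Rank1Residual.ManinAdditive.ShimuraLedger (blindCurve sourceCurve)

section Family

variable {m : ℤ} {p : ℕ} [hp : Fact p.Prime]

/-! ## 3. Rank zero -/

omit hp in
/-- The tree's literal `E_{−2m, p}` is the blind curve `⟨0, −2m, 0, m² + 4, 0⟩`. [folklore] -/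
theorem lit_E (hpm : (p : ℤ) = m ^ 2 + 4) :
    (⟨0, ((-2 * m : ℤ) : ℚ), 0, ((p : ℤ) : ℚ), 0⟩ : WeierstrassCurve ℚ) =
      ⟨0, -2 * (m : ℚ), 0, (m : ℚ) ^ 2 + 4, 0⟩ := by
  rw [hpm]; ext <;> push_cast <;> ring

omit hp in
/-- The tree's half-model `V₀` of `E'_{−2m,p}` is the source curve `⟨0, m, 0, −1, 0⟩`, literally. [folklore] -/
theorem lit_V₀ (hpm : (p : ℤ) = m ^ 2 + 4) :
    (⟨0, -((-2 * m : ℤ) : ℚ) / 2, 0, (((-2 * m : ℤ) : ℚ) ^ 2 - 4 * ((p : ℤ) : ℚ)) / 16, 0⟩ : WeierstrassCurve ℚ) =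
      ⟨0, (m : ℚ), 0, -1, 0⟩ := by
  rw [hpm]; ext <;> push_cast <;> ring

/-- **`rank E'_m(ℚ) = 0`** for every odd `m` with `m² + 4` prime: `rank + 2 ≤ dim₂ S^{(φ̂)} + dim₂ S^{(φ)} = 2`
(the tree's proved `twoIsogeny_mordellWeilRank_add_two_le_holds`). [cite: SilvermanTate2015, §3.6 (2^r = #α(Γ)·#ᾱ(Γ̄)/4)] -/
theorem mordellWeilRank_blind_eq_zero (hpm : (p : ℤ) = m ^ 2 + 4) (hm : Odd m) :
    (⟨0, -2 * (m : ℚ), 0, (m : ℚ) ^ 2 + 4, 0⟩ : WeierstrassCurve ℚ).mordellWeilRank = 0 := by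
  have h := twoIsogeny_mordellWeilRank_add_two_le_holds (-2 * m) (p : ℤ) (hab hpm)
  rw [selmerRank_blind_eq hpm, selmerRank'_blind_eq hpm hm, lit_E hpm] at h
  omega

/-- The same, by name: `rank (blindCurve m)(ℚ) = 0`. [folklore] -/
theorem mordellWeilRank_blindCurve_eq_zero (hpm : (p : ℤ) = m ^ 2 + 4) (hm : Odd m) :
    (blindCurve m).mordellWeilRank = 0 :=
  mordellWeilRank_blind_eq_zero hpm hm

/-! ## 4. The images of `α`, `ᾱ` and `Ш` -/

/-- **`#α ≥ 2` when `b` is a prime**: on `E_{A,B}` with `B = p` the classes `α(O) = 1` and `α(T) = [B] = [p]`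
differ (`√p` is irrational). [cite: SilvermanTate2015, §3.5 (α(T) = b mod squares)] -/
theorem two_le_natCard_range_of_prime {A B : ℤ} (hAB : B * (A ^ 2 - 4 * B) ≠ 0) (hB : B = (p : ℤ)) :
    2 ≤ Nat.card (Set.range (⟨0, (A : ℚ), 0, (B : ℚ), 0⟩ : WeierstrassCurve ℚ).xSqClass) := by
  haveI := isElliptic_mk_of_ne_zero (F := ℚ) hAB
  obtain ⟨hfin, -⟩ := natCard_range_xSqClass_le (a := A) (b := B) hAB
  set W := (⟨0, (A : ℚ), 0, (B : ℚ), 0⟩ : WeierstrassCurve ℚ) with hW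
  have h1 : (1 : SqUnits ℚ) ∈ Set.range W.xSqClass := ⟨0, xSqClass_zero W⟩
  have hT : sqClass W.a₄ ∈ Set.range W.xSqClass := ⟨W.twoTorsionPoint, xSqClass_twoTorsionPoint W⟩
  have hne : (1 : SqUnits ℚ) ≠ sqClass W.a₄ := by
    intro h
    have ha₄ : W.a₄ = (B : ℚ) := rfl
    rw [ha₄] at h
    have hB0 : (B : ℚ) ≠ 0 := by exact_mod_cast left_ne_zero_of_mul hAB
    obtain ⟨u, hu⟩ := (sqClass_eq_one_iff hB0).mp h.symm
    have hirr : Irrational (√(p : ℕ)) := Nat.Prime.irrational_sqrt hp.out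
    refine hirr ⟨|u|, ?_⟩
    have h' : ((u : ℝ)) ^ 2 = (p : ℝ) := by
      have : (u : ℚ) ^ 2 = (p : ℚ) := by rw [← hu, hB]; push_cast; ring
      exact_mod_cast this
    rw [Rat.cast_abs, ← Real.sqrt_sq_eq_abs, h']
  rw [Nat.card_coe_set_eq]
  exact (Set.one_lt_ncard hfin).mpr ⟨1, h1, sqClass W.a₄, hT, hne⟩

omit hp in
/-- **`#α ≥ 2` when `b < 0`**: on `E_{A,B}` with `B < 0` the classes `1` and `[B]` differ (`B` is not a
square). [cite: SilvermanTate2015, §3.5 (α(T) = b mod squares)] -/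
theorem two_le_natCard_range_of_neg {A B : ℤ} (hAB : B * (A ^ 2 - 4 * B) ≠ 0) (hB : B < 0) :
    2 ≤ Nat.card (Set.range (⟨0, (A : ℚ), 0, (B : ℚ), 0⟩ : WeierstrassCurve ℚ).xSqClass) := by
  haveI := isElliptic_mk_of_ne_zero (F := ℚ) hAB
  obtain ⟨hfin, -⟩ := natCard_range_xSqClass_le (a := A) (b := B) hAB
  set W := (⟨0, (A : ℚ), 0, (B : ℚ), 0⟩ : WeierstrassCurve ℚ) with hW
  have h1 : (1 : SqUnits ℚ) ∈ Set.range W.xSqClass := ⟨0, xSqClass_zero W⟩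
  have hT : sqClass W.a₄ ∈ Set.range W.xSqClass := ⟨W.twoTorsionPoint, xSqClass_twoTorsionPoint W⟩
  have hne : (1 : SqUnits ℚ) ≠ sqClass W.a₄ := by
    intro h
    have ha₄ : W.a₄ = (B : ℚ) := rfl
    rw [ha₄] at h
    have hB0 : (B : ℚ) ≠ 0 := by exact_mod_cast left_ne_zero_of_mul hAB
    obtain ⟨u, hu⟩ := (sqClass_eq_one_iff hB0).mp h.symm
    have hBq : (B : ℚ) < 0 := by exact_mod_cast hB
    nlinarith [sq_nonneg u]
  rw [Nat.card_coe_set_eq]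
  exact (Set.one_lt_ncard hfin).mpr ⟨1, h1, sqClass W.a₄, hT, hne⟩

/-- **`Ш(E'_m/ℚ)[φ] = 0`** as `Ш(E'_m) ∩ im Ξ = ⊥`: `2^{dim S^{(φ)}} = 2 = #ᾱ · #Ш[Ξ]` with `#ᾱ ≥ 2`.
[cite: SilvermanAEC2009, Thm. X.4.2(a) and Prop. X.4.9] -/
theorem sha_inf_range_eq_bot (hpm : (p : ℤ) = m ^ 2 + 4) (hm : Odd m)
    [hE : (⟨0, ((-2 * m : ℤ) : ℚ), 0, ((p : ℤ) : ℚ), 0⟩ : WeierstrassCurve ℚ).IsElliptic] :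
    (⟨0, ((-2 * m : ℤ) : ℚ), 0, ((p : ℤ) : ℚ), 0⟩ : WeierstrassCurve ℚ).sha ⊓
      (⟨0, ((-2 * m : ℤ) : ℚ), 0, ((p : ℤ) : ℚ), 0⟩ : WeierstrassCurve ℚ).twoIsogenyTorsorHom.range = ⊥ := by
  have key := two_pow_twoIsogenySelmerRank'_eq_natCard_mul (a := -2 * m) (b := (p : ℤ)) (hab hpm)
  rw [selmerRank'_blind_eq hpm hm, pow_one] at key
  have hx := two_le_natCard_range_of_neg (A := -2 * (-2 * m)) (B := (-2 * m) ^ 2 - 4 * (p : ℤ))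
    (twoIsogenyCodomain_ne_zero (hab hpm)) (by rw [disc_eq hpm]; norm_num)
  have hx2 := le_antisymm (Nat.le_of_dvd two_pos ⟨_, key⟩) hx
  rw [hx2] at key
  rw [← AddSubgroup.card_eq_one]
  omega

/-- **`Ш(E_m/ℚ)[φ̂] = 0`** (for the half-model `V₀ = sourceCurve m`, `V₀' = E'_m` literally) as
`Ш(V₀) ∩ im Ξ₀ = ⊥`: `2^{dim S^{(φ̂)}} = 2 = #α · #Ш[Ξ₀]` with `#α ≥ 2`. [cite: SilvermanAEC2009, Thm. X.4.2(a) and Prop. X.4.9] -/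
theorem sha_halfModel_inf_range_eq_bot (hpm : (p : ℤ) = m ^ 2 + 4)
    [hV₀ : (⟨0, -((-2 * m : ℤ) : ℚ) / 2, 0, (((-2 * m : ℤ) : ℚ) ^ 2 - 4 * ((p : ℤ) : ℚ)) / 16, 0⟩ :
      WeierstrassCurve ℚ).IsElliptic] :
    (⟨0, -((-2 * m : ℤ) : ℚ) / 2, 0, (((-2 * m : ℤ) : ℚ) ^ 2 - 4 * ((p : ℤ) : ℚ)) / 16, 0⟩ : WeierstrassCurve ℚ).sha ⊓
      (⟨0, -((-2 * m : ℤ) : ℚ) / 2, 0, (((-2 * m : ℤ) : ℚ) ^ 2 - 4 * ((p : ℤ) : ℚ)) / 16, 0⟩ :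
        WeierstrassCurve ℚ).twoIsogenyTorsorHom.range = ⊥ := by
  have key := two_pow_twoIsogenySelmerRank_eq_natCard_mul_halfModel (a := -2 * m) (b := (p : ℤ)) (hab hpm)
  rw [selmerRank_blind_eq hpm, pow_one] at key
  have hx := two_le_natCard_range_of_prime (A := -2 * m) (B := (p : ℤ)) (hab hpm) rfl
  have hx2 := le_antisymm (Nat.le_of_dvd two_pos ⟨_, key⟩) hx
  rw [hx2] at key
  rw [← AddSubgroup.card_eq_one]
  omega

/-- **`Ш(E'_m/ℚ)[2] = 0`** for every odd `m` with `m² + 4` prime: every `c ∈ Ш(E'_m/ℚ)` with `2c = 0` is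
trivial (`Ш[φ] = 0` and `Ш'[φ̂] = 0` with `φ̂ ∘ φ = [2]`, the tree's `forall_mem_sha_two_smul_eq_zero_of_halfModel`).
[cite: SilvermanAEC2009, Example X.4.10 (method) with Thm. X.4.2(a)] -/
theorem sha_blind_two_torsion_eq_zero (hpm : (p : ℤ) = m ^ 2 + 4) (hm : Odd m) :
    ∀ c ∈ (⟨0, -2 * (m : ℚ), 0, (m : ℚ) ^ 2 + 4, 0⟩ : WeierstrassCurve ℚ).sha, 2 • c = 0 → c = 0 := by
  haveI hV₀ := isElliptic_halfModel (a := -2 * m) (b := (p : ℤ)) (hab hpm)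
  haveI hE := isElliptic_mk_of_ne_zero (F := ℚ) (hab hpm)
  have h := forall_mem_sha_two_smul_eq_zero_of_halfModel (a := -2 * m) (b := (p : ℤ))
    (sha_halfModel_inf_range_eq_bot hpm) (sha_inf_range_eq_bot hpm hm)
  rw [lit_E hpm] at h
  exact h

/-- The same, by name: `Ш(blindCurve m/ℚ)[2] = 0`. [folklore] -/
theorem sha_blindCurve_two_torsion_eq_zero (hpm : (p : ℤ) = m ^ 2 + 4) (hm : Odd m) :
    ∀ c ∈ (blindCurve m).sha, 2 • c = 0 → c = 0 :=
  sha_blind_two_torsion_eq_zero hpm hm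


/-! ## 5. The same descent read from the partner `E_m = sourceCurve m : y² = x³ + m x² − x`
(`(a, b) = (m, −1)`, `a² − 4b = m² + 4 = p`; its `2`-isogenous curve is `E'_m` LITERALLY) -/

omit hp in
/-- `b (a² − 4b) = −p ≠ 0` for `(a, b) = (m, −1)`. [folklore] -/
theorem hab₂ (m : ℤ) : (-1 : ℤ) * (m ^ 2 - 4 * (-1)) ≠ 0 := by nlinarith [sq_nonneg m]

omit hp in
/-- **`S^{(φ̂)} = S(m, −1) = {1, −1}`** (descent on the divisors of `b = −1`): both classes are hit (`α(O) = 1`,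
`α(T) = [−1]`). [cite: SilvermanTate2015, §3.6 eq. (**)] -/
theorem selmer_source_eq (m : ℤ) : twoIsogenySelmerGroup m (-1) = {1, -1} := by
  have h1 : (-1 : ℤ) ≠ 0 := by norm_num
  ext d
  simp only [Finset.mem_insert, Finset.mem_singleton]
  constructor
  · intro hd
    obtain ⟨-, hdvd, -⟩ := (mem_twoIsogenySelmerGroup_iff h1).mp hd
    exact Int.isUnit_iff.mp (isUnit_of_dvd_unit hdvd isUnit_one.neg)
  · rintro (rfl | rfl)
    · exact one_mem_twoIsogenySelmerGroup _ h1
    · exact self_mem_twoIsogenySelmerGroup _ isUnit_one.neg.squarefree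

/-- **`S^{(φ)} = S'(m, −1) = S(−2m, m² + 4) = {1, p}`.** [cite: SilvermanAEC2009, Prop. X.4.9] -/
theorem selmer'_source_eq (hpm : (p : ℤ) = m ^ 2 + 4) :
    twoIsogenySelmerGroup' m (-1) = {1, (p : ℤ)} := by
  rw [twoIsogenySelmerGroup'_eq, show m ^ 2 - 4 * (-1) = (p : ℤ) by rw [hpm]; ring]
  exact selmer_blind_eq hpm

omit hp in
/-- `dim₂ S(m, −1) = 1`. [folklore] -/
theorem selmerRank_source_eq (m : ℤ) : twoIsogenySelmerRank m (-1) = 1 := by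
  rw [twoIsogenySelmerRank, selmer_source_eq, Finset.card_insert_of_notMem (by simp), Finset.card_singleton]
  exact Nat.log_pow Nat.one_lt_two 1

/-- `dim₂ S'(m, −1) = 1`. [folklore] -/
theorem selmerRank'_source_eq (hpm : (p : ℤ) = m ^ 2 + 4) : twoIsogenySelmerRank' m (-1) = 1 := by
  have h2 : (1 : ℤ) ≠ (p : ℤ) := by exact_mod_cast hp.out.one_lt.ne
  rw [twoIsogenySelmerRank'_eq, selmer'_source_eq hpm, Finset.card_insert_of_notMem (by simpa using h2),
    Finset.card_singleton]
  exact Nat.log_pow Nat.one_lt_two 1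

omit hp in
/-- The tree's literal `E_{m, −1}` is the source curve `⟨0, m, 0, −1, 0⟩`. [folklore] -/
theorem lit_E₂ (m : ℤ) :
    (⟨0, ((m : ℤ) : ℚ), 0, ((-1 : ℤ) : ℚ), 0⟩ : WeierstrassCurve ℚ) = ⟨0, (m : ℚ), 0, -1, 0⟩ := by
  ext <;> push_cast <;> ring

/-- **`rank E_m(ℚ) = 0`** (`rank + 2 ≤ dim₂ S(m,−1) + dim₂ S'(m,−1) = 2`). [cite: SilvermanTate2015, §3.6 (2^r = #α(Γ)·#ᾱ(Γ̄)/4)] -/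
theorem mordellWeilRank_source_eq_zero (hpm : (p : ℤ) = m ^ 2 + 4) :
    (⟨0, (m : ℚ), 0, -1, 0⟩ : WeierstrassCurve ℚ).mordellWeilRank = 0 := by
  have h := twoIsogeny_mordellWeilRank_add_two_le_holds m (-1) (hab₂ m)
  rw [selmerRank_source_eq, selmerRank'_source_eq hpm, lit_E₂] at h
  omega

/-- The same, by name: `rank (sourceCurve m)(ℚ) = 0`. [folklore] -/
theorem mordellWeilRank_sourceCurve_eq_zero (hpm : (p : ℤ) = m ^ 2 + 4) :
    (sourceCurve m).mordellWeilRank = 0 :=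
  mordellWeilRank_source_eq_zero hpm

/-- **`Ш(E_m/ℚ)[φ] = 0`** as `Ш(E_m) ∩ im Ξ = ⊥`: `2^{dim S'(m,−1)} = 2 = #ᾱ · #Ш[Ξ]`, `#ᾱ ≥ 2` (`[p] ≠ 1` on
`E_{−2m, m²+4}`). [cite: SilvermanAEC2009, Thm. X.4.2(a) and Prop. X.4.9] -/
theorem sha_source_inf_range_eq_bot (hpm : (p : ℤ) = m ^ 2 + 4)
    [hE : (⟨0, ((m : ℤ) : ℚ), 0, ((-1 : ℤ) : ℚ), 0⟩ : WeierstrassCurve ℚ).IsElliptic] :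
    (⟨0, ((m : ℤ) : ℚ), 0, ((-1 : ℤ) : ℚ), 0⟩ : WeierstrassCurve ℚ).sha ⊓
      (⟨0, ((m : ℤ) : ℚ), 0, ((-1 : ℤ) : ℚ), 0⟩ : WeierstrassCurve ℚ).twoIsogenyTorsorHom.range = ⊥ := by
  have key := two_pow_twoIsogenySelmerRank'_eq_natCard_mul (a := m) (b := -1) (hab₂ m)
  rw [selmerRank'_source_eq hpm, pow_one] at key
  have hx := two_le_natCard_range_of_prime (A := -2 * m) (B := m ^ 2 - 4 * (-1))
    (twoIsogenyCodomain_ne_zero (hab₂ m)) (by rw [hpm]; ring)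
  have hx2 := le_antisymm (Nat.le_of_dvd two_pos ⟨_, key⟩) hx
  rw [hx2] at key
  rw [← AddSubgroup.card_eq_one]
  omega

omit hp in
/-- **`Ш(E'_m-model/ℚ)[φ̂] = 0`** for the half-model `V₀ = ⟨0, −m/2, 0, (m²+4)/16, 0⟩ of `E'_m` (`V₀' = E_m`
literally), as `Ш(V₀) ∩ im Ξ₀ = ⊥`: `2^{dim S(m,−1)} = 2 = #α · #Ш[Ξ₀]`, `#α ≥ 2` (`[−1] ≠ 1`).
[cite: SilvermanAEC2009, Thm. X.4.2(a) and Prop. X.4.9] -/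
theorem sha_source_halfModel_inf_range_eq_bot (m : ℤ)
    [hV₀ : (⟨0, -((m : ℤ) : ℚ) / 2, 0, (((m : ℤ) : ℚ) ^ 2 - 4 * ((-1 : ℤ) : ℚ)) / 16, 0⟩ :
      WeierstrassCurve ℚ).IsElliptic] :
    (⟨0, -((m : ℤ) : ℚ) / 2, 0, (((m : ℤ) : ℚ) ^ 2 - 4 * ((-1 : ℤ) : ℚ)) / 16, 0⟩ : WeierstrassCurve ℚ).sha ⊓
      (⟨0, -((m : ℤ) : ℚ) / 2, 0, (((m : ℤ) : ℚ) ^ 2 - 4 * ((-1 : ℤ) : ℚ)) / 16, 0⟩ :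
        WeierstrassCurve ℚ).twoIsogenyTorsorHom.range = ⊥ := by
  have key := two_pow_twoIsogenySelmerRank_eq_natCard_mul_halfModel (a := m) (b := -1) (hab₂ m)
  rw [selmerRank_source_eq, pow_one] at key
  have hx := two_le_natCard_range_of_neg (A := m) (B := -1) (hab₂ m) (by norm_num)
  have hx2 := le_antisymm (Nat.le_of_dvd two_pos ⟨_, key⟩) hx
  rw [hx2] at key
  rw [← AddSubgroup.card_eq_one]
  omega

/-- **`Ш(E_m/ℚ)[2] = 0`** for every odd or even `m` with `m² + 4` prime (the partner's `2`-part).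
[cite: SilvermanAEC2009, Example X.4.10 (method) with Thm. X.4.2(a)] -/
theorem sha_source_two_torsion_eq_zero (hpm : (p : ℤ) = m ^ 2 + 4) :
    ∀ c ∈ (⟨0, (m : ℚ), 0, -1, 0⟩ : WeierstrassCurve ℚ).sha, 2 • c = 0 → c = 0 := by
  haveI hV₀ := isElliptic_halfModel (a := m) (b := -1) (hab₂ m)
  haveI hE := isElliptic_mk_of_ne_zero (F := ℚ) (hab₂ m)
  have h := forall_mem_sha_two_smul_eq_zero_of_halfModel (a := m) (b := -1)
    (sha_source_halfModel_inf_range_eq_bot m) (sha_source_inf_range_eq_bot hpm)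
  rw [lit_E₂] at h
  exact h

/-- The same, by name: `Ш(sourceCurve m/ℚ)[2] = 0`. [folklore] -/
theorem sha_sourceCurve_two_torsion_eq_zero (hpm : (p : ℤ) = m ^ 2 + 4) :
    ∀ c ∈ (sourceCurve m).sha, 2 • c = 0 → c = 0 :=
  sha_source_two_torsion_eq_zero hpm

/-! ## 6. Summary: the blind families are `2`-Selmer-minimal -/

/-- **THEOREM (an g23, MEMO-an §65): the blind isogeny class `{E_m, E'_m}` is `2`-Selmer-minimal.**  For every
odd `m` with `p = m² + 4` prime: `S^{(φ̂)} = {1, p}`, `S^{(φ)} = {1, −1}` (both of order `2`, both exhausted by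
`2`-torsion), `rank E'_m(ℚ) = rank E_m(ℚ) = 0`, `Ш(E'_m/ℚ)[2] = 0`, `Ш(E_m/ℚ)[2] = 0`.  (`c`-free, `L`-free;
both signs of `m`, both residues mod `4`, i.e. both the tame `N = 4p` and the wild `N = 16p` family.)
[cite: SilvermanTate2015, §3.6] [cite: SilvermanAEC2009, X.4.9, X.4.2(a)] -/
theorem blindFamily_twoSelmerMinimal (hpm : (p : ℤ) = m ^ 2 + 4) (hm : Odd m) :
    twoIsogenySelmerGroup (-2 * m) (p : ℤ) = {1, (p : ℤ)} ∧ twoIsogenySelmerGroup' (-2 * m) (p : ℤ) = {1, -1} ∧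
    (blindCurve m).mordellWeilRank = 0 ∧ (sourceCurve m).mordellWeilRank = 0 ∧
    (∀ c ∈ (blindCurve m).sha, 2 • c = 0 → c = 0) ∧ (∀ c ∈ (sourceCurve m).sha, 2 • c = 0 → c = 0) :=
  ⟨selmer_blind_eq hpm, selmer'_blind_eq hpm hm, mordellWeilRank_blindCurve_eq_zero hpm hm,
    mordellWeilRank_sourceCurve_eq_zero hpm, sha_blindCurve_two_torsion_eq_zero hpm hm,
    sha_sourceCurve_two_torsion_eq_zero hpm⟩

end Family

/-! ## 7. Consequences (MEMO-an §65 (B)) -/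


/-- **`Ш[2] = 0` ⇒ `#Ш` odd** (for finite `Ш`; Cauchy). [folklore] -/
theorem not_two_dvd_shaOrder_of_sha_two (W : WeierstrassCurve ℚ) [Finite W.sha]
    (h : ∀ c ∈ W.sha, 2 • c = 0 → c = 0) : ¬ 2 ∣ W.shaOrder := by
  intro hdvd
  haveI : Fact (Nat.Prime 2) := ⟨Nat.prime_two⟩
  obtain ⟨c, hc⟩ := exists_prime_addOrderOf_dvd_card' (G := W.sha) 2 hdvd
  have h2 : 2 • (c : W.galH1) = 0 := by
    have := addOrderOf_nsmul_eq_zero c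
    rw [hc] at this
    simpa using congrArg ((↑) : W.sha → W.galH1) this
  have hc0 : c = 0 := Subtype.ext (h c c.2 h2)
  rw [hc0, addOrderOf_zero] at hc
  exact absurd hc (by norm_num)


section Consequences

variable {m : ℤ} {p : ℕ} [hp : Fact p.Prime]

/-- `E'_m` is an elliptic curve (instance for the named model). [folklore] -/
theorem isElliptic_blindCurve (hpm : (p : ℤ) = m ^ 2 + 4) : (blindCurve m).IsElliptic := by
  have h := isElliptic_mk_of_ne_zero (F := ℚ) (hab hpm)
  rw [lit_E hpm] at h
  exact h

/-- **`E'_m(ℚ)` is finite** (rank `0` and the tree's proved Mordell–Weil theorem). [cite: SilvermanAEC2009, Thm. VIII.6.7] -/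
theorem finite_point_blindCurve (hpm : (p : ℤ) = m ^ 2 + 4) (hm : Odd m) :
    Finite (blindCurve m).toAffine.Point := by
  haveI := isElliptic_blindCurve hpm
  exact (blindCurve m).mordellWeilRank_eq_zero_iff_finite.mp (mordellWeilRank_blindCurve_eq_zero hpm hm)

/-- **`Reg(E'_m/ℚ) = 1`.** [cite: SilvermanAEC2009, §VIII.9 Definition p. 253 and C.16] -/
theorem regulator_blindCurve (hpm : (p : ℤ) = m ^ 2 + 4) (hm : Odd m) : (blindCurve m).regulator = 1 := by
  haveI := isElliptic_blindCurve hpm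
  exact (blindCurve m).regulator_eq_one_of_rank_zero (mordellWeilRank_blindCurve_eq_zero hpm hm)

/-- **`#Ш(E'_m/ℚ)` is odd** (once finite). [folklore] -/
theorem not_two_dvd_shaOrder_blindCurve (hpm : (p : ℤ) = m ^ 2 + 4) (hm : Odd m)
    [Finite (blindCurve m).sha] : ¬ 2 ∣ (blindCurve m).shaOrder :=
  not_two_dvd_shaOrder_of_sha_two _ (sha_blindCurve_two_torsion_eq_zero hpm hm)

end Consequences


end Summit.BirchSwinnertonDyer.BirchSwinnertonDyer.Theorems.ManinLocalTwoThree.BlindFamilyDescent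

end
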